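import Summits.QuantumFields.BalabanUV.T4Continuum.Support.NE7HessianFloorModGauge
import HarnessLib

/-!
# NE7SliceRepLetters — ALL THE LETTERS OF THE MULTI-LEVEL SLICE REPRESENTATIVE IN ONE EXISTENTIAL (d = 4, j-, N-uniform): for every skew fine torus field `X` there is a corner-trivial `μ` with
# `X′ = X + ξ_μ` such that (a) `levelQ′ X′ = levelQ′ X`, (b) `X̃′ − R₀ṽ ∈ T_♮(U)` (row NE3's frame-free block-Landau slice), (c) the HESSIAN FLOOR of G4, (d) the ABSORBED SCALED MASS
# `q·dirSq X̃′ ≤ 2·(4C_P n)·hess U X̃′ X̃′ + 2·(2liftMassC + 4C_P liftCurlC)·‖ṽ‖²` and (e) the FINE CURL ENERGY `Σ_p nhs(curl_U X̃′) ≤ (1 + 112·#pl·ε·C_P n)·hess + 28·#pl·ε·(…)‖ṽ‖²`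
# (lineage `b2b-balaban-t4-ne7-p1`, gen 118, file G11; the input record for the multiplier analysis on `X′` and for G7's representative system `S = R₀ṽ + T_♮(U)`)

Cell `pub-balaban`, rung (B)+1 sub-cell t4, CRUX PROVER NE7 #1 (OWNER of row NE7), generation 118.  Composition BY NAME of this gen's G1–G4 (✓ `NE7SliceRepFibrePoincare`, ✓ `NE7SliceRepHessianFloor`,
✓ `NE7SliceRepExists`, ✓ `NE7HessianFloorModGauge`) with ✓ `NE7HessDominatesCoarseCurl.hess_self_ge_nhs`∕`sum_bondSq_perWin_le` (the absorption step of gen 117's F9, exported).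
WHAT ([folklore]; 0 def, 0 sorry; `d = 4`): §1 `scaledMass_le_of_sliceRep`, `fineEnergy_le_of_sliceRep` (abstract frame-free lift `R` with letters `A`, `B`; tangent part `Y` frame-free with the
η-weighted Poincaré letter); §2 **`exists_cornerGauge_sliceRep_letters`** ((a)–(e) for `R = R₀ṽ` under row NE3's slice Poincaré SHAPE `hSP`).
HONEST FRAMING: algebra over landed kernel theorems about OUR objects; the multiplier term is NOT bounded here; nothing of Bałaban's asserted; NOT (G′), NOT NE7 as a spine node, NOT NE3;
spine 0∕9; finite T⁴ rung (B)+1 — NOT infinite volume, NOT mass gap, NOT BetaPertH, NOT Clay.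
-/

set_option autoImplicit false

open scoped BigOperators Matrix Matrix.Norms.L2Operator
open NormedSpace Finset

namespace Summit.QuantumFields.BalabanUV.T4Continuum.NE7SliceRepLetters

open Literature.MathematicalPhysics.QuantumFieldTheory.Balaban1983to89
open B7Prop1Explicit B7Prop2Explicit MatrixLog UnitaryModel
open T4AveragingDeficitWall (IsUnitaryCfg IsSkewDir SmallField Ad curl curlAt curlSq dirSq)
open T4AveragingDeficitWallBoundary (IsPeriodicCfg periodBox)
open AveragingDeficitPeriodicCounting (IsPeriodicDir)
open AveragingDeficitTorusChart (TDir chartDir resDir isPeriodicDir_chartDir)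
open AveragingDeficitTwoLevelPrep (twoLevelSmall skewSub skewPR prop1Radius)
open AveragingDeficitMultiLevelPrep (cavgIter tower levelQ' tower_ne_zero LevelSmall natCast_tower_succ)
open MatrixNorms (nhsNormSq nhsNormSq_nonneg)
open MinimalActionLevels (perWin)
open NE3HessForm (hess)
open NE3HessBounds (bondSq)
open NE3TangentCovariantTower (framePotW dirIter)
open NE3EnergyHessContTwoTerm (dirSq_nonneg)
open NE7RadIterUniform (radD levelSmall_of_class_radius)
open NE7StraightTowerCurlEnergy (eC mC eC_nonneg)
open NE7FlatAverageCurlCommutation (isSkewDir_chartDir_id)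
open NE7FrameCorrectedCurlEnergyTower (chartDir_levelQ'_eq_dirIter)
open NE7HessDominatesCoarseCurl (hess_self_ge_nhs sum_bondSq_perWin_le)
open BlockAveragePushDirGauge (gaugeDir isPeriodicDir_gaugeDir)
open NE3LandauOrbit (gaugeDir_skew)
open NE3QbarIterCovLiftPrep (cruxC)
open NE3RightInverseSolveLetters (thetaLoc)
open NE3SlicePoincareShape (SlicePoincare)
open NE3FrameFreeSliceW (frameFreeBlockLandauW)
open NE3EnergyRateWSupOfSlicePoincare (tower_eq_mul_pow)
open NE7FrameFreeRightInverse (rightInvW0 framePotW_rightInvW0)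
open NE7SliceRepFibrePoincare (fibre_poincare_nhs framePotW_eq_zero_of_add)
open NE7SliceRepHessianFloor (liftMassC liftCurlC dirSq_rightInvW0_class_le curlSq_rightInvW0_class_le coarse_curl_le_hess_of_mem_slice sliceRep_args sq_mul_classRadius_eq
  inv_pow_sq_eq)
open NE7SliceRepExists (exists_cornerGauge_sliceRep)
open NE7HessianFloorModGauge (chartDir_add_skewPR_resDir eq_of_chartDir_eq)
open SpreadLift (loopRad)

noncomputable section

variable {n : Type*} [Fintype n] [DecidableEq n]

/-! ## §1 The absorbed scaled mass and the fine curl energy of a two-term slice representative (`d = 4`) -/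

/-- **ABSORBED SCALED MASS OF A TWO-TERM SLICE REPRESENTATIVE** (`d = 4`): class configuration `U`, `X̃ = R + Y` with `R` frame-free, `dirSq R ≤ A`, `curlSq U R ≤ B`, `Y` with the η-weighted
Poincaré letter of constant `C_P`, absorption line `28·#pl·ε·(4C_P n) ≤ 1`; then `q·dirSq X̃ ≤ 2·(4C_P n)·hess U X̃ X̃ (perWin 4 (tower L N (j+1))) + 2·(2qA + 4C_P B)` and
`Σ_{p∈perWin} nhsNormSq (curl U X̃ p) ≤ (1 + 14·#pl·ε·2·(4C_P n))·hess + 14·#pl·ε·2·(2qA + 4C_P B)` (`q = (L⁻¹)^{2(j+1)}`). [cite: Balaban1985BackgroundPropagators, (3.10) p.391] -/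
theorem scaledMass_le_of_sliceRep [Nonempty n] {L N : ℕ} [NeZero L] [NeZero N] {ε : ℝ} (hε : 0 ≤ ε) (j : ℕ)
    {U : Site 4 → Fin 4 → (Matrix n n ℂ)ˣ} (hU : IsUnitaryCfg U) (hUx : SmallField U (ε * (((L : ℝ) ^ 2)⁻¹) ^ (j + 1)))
    {X : TDir 4 n (L * tower L N j)} (hX : X ∈ skewSub 4 n (L * tower L N j))
    {R : Site 4 → Fin 4 → Matrix n n ℂ} {A B CP : ℝ} (hCP : 0 ≤ CP)
    (hRA : dirSq R (periodBox (tower L N (j + 1))) ≤ A) (hRB : curlSq U R (periodBox (tower L N (j + 1))) ≤ B)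
    (hYP : ((L : ℝ)⁻¹) ^ (2 * (j + 1)) * dirSq (fun y ν => chartDir (ContinuousLinearMap.id ℝ (Matrix n n ℂ)) (L * tower L N j) X y ν - R y ν) (periodBox (tower L N (j + 1)))
      ≤ CP * curlSq U (fun y ν => chartDir (ContinuousLinearMap.id ℝ (Matrix n n ℂ)) (L * tower L N j) X y ν - R y ν) (periodBox (tower L N (j + 1))))
    (habs : 28 * (Fintype.card (T4AveragingDeficitWall.Plane 4) : ℝ) * ε * (4 * CP * Fintype.card n) ≤ 1) :
    ((L : ℝ)⁻¹) ^ (2 * (j + 1)) * dirSq (chartDir (ContinuousLinearMap.id ℝ (Matrix n n ℂ)) (L * tower L N j) X) (periodBox (tower L N (j + 1)))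
        ≤ 2 * (4 * CP * Fintype.card n) * hess U (chartDir (ContinuousLinearMap.id ℝ (Matrix n n ℂ)) (L * tower L N j) X)
            (chartDir (ContinuousLinearMap.id ℝ (Matrix n n ℂ)) (L * tower L N j) X) (perWin 4 (tower L N (j + 1)))
          + 2 * (2 * ((L : ℝ)⁻¹) ^ (2 * (j + 1)) * A + 4 * CP * B)
      ∧ ∑ p ∈ perWin 4 (tower L N (j + 1)), nhsNormSq (curl U (chartDir (ContinuousLinearMap.id ℝ (Matrix n n ℂ)) (L * tower L N j) X) p)
        ≤ (1 + 14 * (Fintype.card (T4AveragingDeficitWall.Plane 4) : ℝ) * ε * (2 * (4 * CP * Fintype.card n)))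
            * hess U (chartDir (ContinuousLinearMap.id ℝ (Matrix n n ℂ)) (L * tower L N j) X) (chartDir (ContinuousLinearMap.id ℝ (Matrix n n ℂ)) (L * tower L N j) X) (perWin 4 (tower L N (j + 1)))
          + 14 * (Fintype.card (T4AveragingDeficitWall.Plane 4) : ℝ) * ε * (2 * (2 * ((L : ℝ)⁻¹) ^ (2 * (j + 1)) * A + 4 * CP * B)) := by
  have hT1 : 1 ≤ tower L N (j + 1) := Nat.one_le_iff_ne_zero.mpr (tower_ne_zero L N (j + 1))
  set Xt := chartDir (ContinuousLinearMap.id ℝ (Matrix n n ℂ)) (L * tower L N j) X with hXt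
  have hXts : IsSkewDir Xt := isSkewDir_chartDir_id hX
  have hXtP : IsPeriodicDir Xt ((tower L N (j + 1) : ℕ) : ℤ) := isPeriodicDir_chartDir (ContinuousLinearMap.id ℝ (Matrix n n ℂ)) (L * tower L N j) X
  have hdec : ∀ (y : Site 4) (ν : Fin 4), Xt y ν = R y ν + (fun y' ν' => Xt y' ν' - R y' ν') y ν := fun y ν => by simp only [add_sub_cancel]
  have hq : 0 ≤ ((L : ℝ)⁻¹) ^ (2 * (j + 1)) := by positivity
  have hP := fibre_poincare_nhs (W := U) hq hCP (tower L N (j + 1)) hdec hYP hRA hRB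
  -- names
  obtain ⟨E₀, hE₀⟩ : ∃ E₀ : ℝ, E₀ = ∑ p ∈ perWin 4 (tower L N (j + 1)), nhsNormSq (curl U Xt p) := ⟨_, rfl⟩
  obtain ⟨S, hS⟩ : ∃ S : ℝ, S = dirSq Xt (periodBox (tower L N (j + 1))) := ⟨_, rfl⟩
  obtain ⟨H, hH⟩ : ∃ H : ℝ, H = hess U Xt Xt (perWin 4 (tower L N (j + 1))) := ⟨_, rfl⟩
  obtain ⟨q2, hq2⟩ : ∃ q2 : ℝ, q2 = ((L : ℝ)⁻¹) ^ (2 * (j + 1)) := ⟨_, rfl⟩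
  obtain ⟨Pl, hPl⟩ : ∃ Pl : ℝ, Pl = (Fintype.card (T4AveragingDeficitWall.Plane 4) : ℝ) := ⟨_, rfl⟩
  obtain ⟨Rr, hRr⟩ : ∃ Rr : ℝ, Rr = 2 * q2 * A + 4 * CP * B := ⟨_, rfl⟩
  obtain ⟨C', hC'⟩ : ∃ C' : ℝ, C' = 4 * CP * Fintype.card n := ⟨_, rfl⟩
  have hq20 : 0 ≤ q2 := by rw [hq2]; positivity
  have hPl0 : 0 ≤ Pl := by rw [hPl]; positivity
  have hS0 : 0 ≤ S := by rw [hS]; exact dirSq_nonneg _ _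
  have hC'0 : 0 ≤ C' := by rw [hC']; positivity
  rw [← hq2, ← hS, ← hE₀, ← hRr, ← hC'] at hP
  rw [← hPl, ← hC'] at habs
  -- the Hessian bounds the fine curl energy
  have hqq : (((L : ℝ) ^ 2)⁻¹) ^ (j + 1) = q2 := by rw [hq2, inv_pow, inv_pow, ← pow_mul]
  have hhess := hess_self_ge_nhs hU hXts hUx (perWin 4 (tower L N (j + 1)))
  rw [← hE₀, ← hH, hqq] at hhess
  have hbond := sum_bondSq_perWin_le (d := 4) hT1 hXtP
  rw [← hS, ← hPl] at hbond
  have hE₀le : E₀ ≤ H + 14 * Pl * ε * q2 * S := by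
    have h7 : 0 ≤ 7 * (ε * q2) := by positivity
    have h8 := mul_le_mul_of_nonneg_left hbond h7
    have e1 : 7 * (ε * q2) * (2 * Pl * S) = 14 * Pl * ε * q2 * S := by ring
    rw [e1] at h8
    linarith
  -- absorption
  have hmass : q2 * S ≤ 2 * C' * H + 2 * Rr := by
    have h0 := mul_le_mul_of_nonneg_left hE₀le hC'0
    have h1 : q2 * S ≤ C' * (H + 14 * Pl * ε * q2 * S) + Rr := hP.trans (by linarith)
    have h2 : C' * (14 * Pl * ε) * (q2 * S) ≤ (1 / 2) * (q2 * S) := by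
      have h3 : C' * (14 * Pl * ε) ≤ 1 / 2 := by linarith
      exact mul_le_mul_of_nonneg_right h3 (mul_nonneg hq20 hS0)
    have e : C' * (H + 14 * Pl * ε * q2 * S) = C' * H + C' * (14 * Pl * ε) * (q2 * S) := by ring
    rw [e] at h1
    linarith
  rw [← hq2, ← hS, ← hH, ← hE₀, ← hPl, ← hC', ← hRr]
  refine ⟨hmass, ?_⟩
  have h14 : 0 ≤ 14 * Pl * ε := by positivity
  have h15 := mul_le_mul_of_nonneg_left hmass h14
  have e2 : 14 * Pl * ε * (2 * C' * H + 2 * Rr) = 14 * Pl * ε * (2 * C') * H + 14 * Pl * ε * (2 * Rr) := by ring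
  have e3 : 14 * Pl * ε * q2 * S = 14 * Pl * ε * (q2 * S) := by ring
  rw [e2] at h15
  rw [e3] at hE₀le
  have e4 : (1 + 14 * Pl * ε * (2 * C')) * H = H + 14 * Pl * ε * (2 * C') * H := by ring
  rw [e4]
  linarith

/-! ## §2 All the letters of the slice representative through `R₀`, modulo a corner-trivial gauge direction (`d = 4`) -/

/-- **THE MULTI-LEVEL SLICE REPRESENTATIVE'S LETTERS** (`d = 4`, every `U(n)`, `L ≥ 2`, j-, N-uniform constants; hypotheses as G4 ✓ `exists_cornerGauge_hess_floor` with the proof parameters of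
`R₀` displayed — `sliceRep_args` supplies them).  For every `X : skewSub (L·tower L N j)` there is a corner-trivial skew periodic `μ` such that, with `X′ := X + skewPR (res (gaugeDir U μ))`,
`X̃′ := chartDir id ↑X′`, `ṽ := chartDir id N ↑(levelQ′ X)`, `q := (L⁻¹)^{2(j+1)}`, `C′ := 4C_P·n`, `ρ := 2·liftMassC 4 L + 4C_P·liftCurlC 4 L`:
(a) `levelQ′ X′ = levelQ′ X`; (b) `X̃′ − R₀ṽ ∈ frameFreeBlockLandauW L N (j+1) U`; (c) `Σ_{P∈perWin N} nhs(curl V₀ ṽ P) ≤ ((1+θ) + 2K·C′)·hess U X̃′ X̃′ (perWin) + 2K·ρ·‖ṽ‖²`;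
(d) `q·dirSq X̃′ ≤ 2C′·hess U X̃′ X̃′ (perWin) + 2ρ‖ṽ‖²`; (e) `Σ_{p∈perWin} nhs(curl U X̃′ p) ≤ (1 + 14·#pl·ε·2C′)·hess + 14·#pl·ε·2ρ‖ṽ‖²` (`‖ṽ‖² = dirSq ṽ (periodBox N)`).
[cite: Balaban1985Averaging, (48) p.25; Balaban1985PropagatorsII, Thm 3.3 (3.46); Balaban1985Variational, (83) p.290] -/
theorem exists_cornerGauge_sliceRep_letters [Nonempty n] {L N : ℕ} [NeZero L] [NeZero N] (hL : 2 ≤ L) (hN : 1 ≤ N) {ε : ℝ} (hε : 0 ≤ ε)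
    (hεD : 4 * ε * radD 4 L * (((L : ℝ) ^ 2)⁻¹) ^ 2 ≤ 1) (hεT : twoLevelSmall 4 L * (2 * ε * ((L : ℝ) ^ 2)⁻¹) ≤ 1)
    (hεM : 8 * (L : ℝ) * mC 4 L (Fintype.card n) * ε * ((L : ℝ) ^ 2)⁻¹ ≤ 1) (hε1 : ε ≤ 1) (hθl2 : thetaLoc 4 L * ε ≤ 1 / 2) (j : ℕ)
    {U : Site 4 → Fin 4 → (Matrix n n ℂ)ˣ} (hU : IsUnitaryCfg U) (hUP : IsPeriodicCfg U ((tower L N (j + 1) : ℕ) : ℤ))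
    (hUx : SmallField U (ε * (((L : ℝ) ^ 2)⁻¹) ^ (j + 1)))
    (hx : 0 ≤ ε * (((L : ℝ) ^ 2)⁻¹) ^ (j + 1)) (hs : LevelSmall 4 L j (ε * (((L : ℝ) ^ 2)⁻¹) ^ (j + 1)))
    (hcr : cruxC 4 L * (((L : ℝ) ^ (j + 1)) ^ 2 * (ε * (((L : ℝ) ^ 2)⁻¹) ^ (j + 1))) < 1)
    (hE : 4 * ((4 : ℕ) : ℝ) ^ 2 * ((L : ℝ) ^ (j + 1) - 1) ^ 2 * (ε * (((L : ℝ) ^ 2)⁻¹) ^ (j + 1))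
          + 16 * ((4 : ℕ) : ℝ) * loopRad 4 L ((prop1Radius 4 L)^[j] (ε * (((L : ℝ) ^ 2)⁻¹) ^ (j + 1))) ≤ 1 / 2)
    {CP : ℝ} (hCP : 0 ≤ CP) (hSP : SlicePoincare L (j + 1) U (frameFreeBlockLandauW (d := 4) (n := n) L N (j + 1) U) CP (periodBox (N * L ^ (j + 1))))
    (habs : 28 * (Fintype.card (T4AveragingDeficitWall.Plane 4) : ℝ) * ε * (4 * CP * Fintype.card n) ≤ 1) {θ : ℝ} (hθ : 0 < θ)
    (X : ↥(skewSub 4 n (L * tower L N j)))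
    (hvs : IsSkewDir (chartDir (ContinuousLinearMap.id ℝ (Matrix n n ℂ)) N ((levelQ' L N j U (X : TDir 4 n (L * tower L N j)) : ↥(skewSub 4 n N)) : TDir 4 n N))) :
    ∃ mu : Site 4 → Matrix n n ℂ, (∀ y, mu y ∈ skewAdjoint (Matrix n n ℂ))
      ∧ (∀ (y : Site 4) (i : Fin 4), mu (y + ((L * tower L N j : ℕ) : ℤ) • e i) = mu y)
      ∧ (∀ w : Site 4, mu (((L : ℤ) ^ (j + 1)) • w) = 0)
      ∧ levelQ' L N j U ((X + skewPR (d := 4) (n := n) (L * tower L N j) (resDir (L * tower L N j) (gaugeDir U mu)) : ↥(skewSub 4 n (L * tower L N j)))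
            : TDir 4 n (L * tower L N j)) = levelQ' L N j U (X : TDir 4 n (L * tower L N j))
      ∧ (fun y ν => chartDir (ContinuousLinearMap.id ℝ (Matrix n n ℂ)) (L * tower L N j)
              ((X + skewPR (d := 4) (n := n) (L * tower L N j) (resDir (L * tower L N j) (gaugeDir U mu)) : ↥(skewSub 4 n (L * tower L N j))) : TDir 4 n (L * tower L N j)) y ν
            - rightInvW0 hL j hU hx hs hUx N hcr hE hvs y ν) ∈ frameFreeBlockLandauW (d := 4) (n := n) L N (j + 1) U
      ∧ ∑ P ∈ perWin 4 N, nhsNormSq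
          (curl (cavgIter L (j + 1) U) (chartDir (ContinuousLinearMap.id ℝ (Matrix n n ℂ)) N ((levelQ' L N j U (X : TDir 4 n (L * tower L N j)) : ↥(skewSub 4 n N)) : TDir 4 n N)) P)
        ≤ ((1 + θ) + 2 * ((1 + θ) * (14 * (Fintype.card (T4AveragingDeficitWall.Plane 4) : ℝ) * ε) + (1 + θ⁻¹) * (36 * eC 4 L (Fintype.card n) ^ 2 * ε ^ 2))
              * (4 * CP * Fintype.card n))
            * hess U (chartDir (ContinuousLinearMap.id ℝ (Matrix n n ℂ)) (L * tower L N j)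
                  ((X + skewPR (d := 4) (n := n) (L * tower L N j) (resDir (L * tower L N j) (gaugeDir U mu)) : ↥(skewSub 4 n (L * tower L N j))) : TDir 4 n (L * tower L N j)))
                (chartDir (ContinuousLinearMap.id ℝ (Matrix n n ℂ)) (L * tower L N j)
                  ((X + skewPR (d := 4) (n := n) (L * tower L N j) (resDir (L * tower L N j) (gaugeDir U mu)) : ↥(skewSub 4 n (L * tower L N j))) : TDir 4 n (L * tower L N j)))
                (perWin 4 (tower L N (j + 1)))
          + 2 * ((1 + θ) * (14 * (Fintype.card (T4AveragingDeficitWall.Plane 4) : ℝ) * ε) + (1 + θ⁻¹) * (36 * eC 4 L (Fintype.card n) ^ 2 * ε ^ 2))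
              * ((2 * liftMassC 4 L + 4 * CP * liftCurlC 4 L)
                  * dirSq (chartDir (ContinuousLinearMap.id ℝ (Matrix n n ℂ)) N ((levelQ' L N j U (X : TDir 4 n (L * tower L N j)) : ↥(skewSub 4 n N)) : TDir 4 n N))
                      (periodBox N))
      ∧ ((L : ℝ)⁻¹) ^ (2 * (j + 1)) * dirSq (chartDir (ContinuousLinearMap.id ℝ (Matrix n n ℂ)) (L * tower L N j)
              ((X + skewPR (d := 4) (n := n) (L * tower L N j) (resDir (L * tower L N j) (gaugeDir U mu)) : ↥(skewSub 4 n (L * tower L N j))) : TDir 4 n (L * tower L N j)))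
            (periodBox (tower L N (j + 1)))
        ≤ 2 * (4 * CP * Fintype.card n)
            * hess U (chartDir (ContinuousLinearMap.id ℝ (Matrix n n ℂ)) (L * tower L N j)
                  ((X + skewPR (d := 4) (n := n) (L * tower L N j) (resDir (L * tower L N j) (gaugeDir U mu)) : ↥(skewSub 4 n (L * tower L N j))) : TDir 4 n (L * tower L N j)))
                (chartDir (ContinuousLinearMap.id ℝ (Matrix n n ℂ)) (L * tower L N j)
                  ((X + skewPR (d := 4) (n := n) (L * tower L N j) (resDir (L * tower L N j) (gaugeDir U mu)) : ↥(skewSub 4 n (L * tower L N j))) : TDir 4 n (L * tower L N j)))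
                (perWin 4 (tower L N (j + 1)))
          + 2 * ((2 * liftMassC 4 L + 4 * CP * liftCurlC 4 L)
              * dirSq (chartDir (ContinuousLinearMap.id ℝ (Matrix n n ℂ)) N ((levelQ' L N j U (X : TDir 4 n (L * tower L N j)) : ↥(skewSub 4 n N)) : TDir 4 n N)) (periodBox N))
      ∧ ∑ p ∈ perWin 4 (tower L N (j + 1)), nhsNormSq (curl U (chartDir (ContinuousLinearMap.id ℝ (Matrix n n ℂ)) (L * tower L N j)
              ((X + skewPR (d := 4) (n := n) (L * tower L N j) (resDir (L * tower L N j) (gaugeDir U mu)) : ↥(skewSub 4 n (L * tower L N j))) : TDir 4 n (L * tower L N j))) p)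
        ≤ (1 + 14 * (Fintype.card (T4AveragingDeficitWall.Plane 4) : ℝ) * ε * (2 * (4 * CP * Fintype.card n)))
            * hess U (chartDir (ContinuousLinearMap.id ℝ (Matrix n n ℂ)) (L * tower L N j)
                  ((X + skewPR (d := 4) (n := n) (L * tower L N j) (resDir (L * tower L N j) (gaugeDir U mu)) : ↥(skewSub 4 n (L * tower L N j))) : TDir 4 n (L * tower L N j)))
                (chartDir (ContinuousLinearMap.id ℝ (Matrix n n ℂ)) (L * tower L N j)
                  ((X + skewPR (d := 4) (n := n) (L * tower L N j) (resDir (L * tower L N j) (gaugeDir U mu)) : ↥(skewSub 4 n (L * tower L N j))) : TDir 4 n (L * tower L N j)))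
                (perWin 4 (tower L N (j + 1)))
          + 14 * (Fintype.card (T4AveragingDeficitWall.Plane 4) : ℝ) * ε * (2 * ((2 * liftMassC 4 L + 4 * CP * liftCurlC 4 L)
              * dirSq (chartDir (ContinuousLinearMap.id ℝ (Matrix n n ℂ)) N ((levelQ' L N j U (X : TDir 4 n (L * tower L N j)) : ↥(skewSub 4 n N)) : TDir 4 n N)) (periodBox N))) := by
  have hL1 : 1 ≤ L := by omega
  have hLd : 2 ≤ L ^ 4 := le_trans hL (Nat.le_self_pow (by norm_num) L)
  have hMx := sq_mul_classRadius_eq hL1 ε j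
  have hθl2' : thetaLoc 4 L * (((L : ℝ) ^ (j + 1)) ^ 2 * (ε * (((L : ℝ) ^ 2)⁻¹) ^ (j + 1))) ≤ 1 / 2 := by rw [hMx]; exact hθl2
  have hε1' : ((L : ℝ) ^ (j + 1)) ^ 2 * (ε * (((L : ℝ) ^ 2)⁻¹) ^ (j + 1)) ≤ 1 := by rw [hMx]; exact hε1
  have hUP' : IsPeriodicCfg U ((L : ℤ) * (tower L N j : ℕ)) := by rw [← natCast_tower_succ]; exact hUP
  set Xt := chartDir (ContinuousLinearMap.id ℝ (Matrix n n ℂ)) (L * tower L N j) (X : TDir 4 n (L * tower L N j)) with hXt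
  set vt := chartDir (ContinuousLinearMap.id ℝ (Matrix n n ℂ)) N ((levelQ' L N j U (X : TDir 4 n (L * tower L N j)) : ↥(skewSub 4 n N)) : TDir 4 n N) with hvt
  have hXts : IsSkewDir Xt := isSkewDir_chartDir_id X.2
  have hXtP : IsPeriodicDir Xt ((tower L N (j + 1) : ℕ) : ℤ) := isPeriodicDir_chartDir (ContinuousLinearMap.id ℝ (Matrix n n ℂ)) (L * tower L N j) (X : TDir 4 n (L * tower L N j))
  have hvP : IsPeriodicDir vt (N : ℤ) := isPeriodicDir_chartDir (ContinuousLinearMap.id ℝ (Matrix n n ℂ)) N _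
  have hXφ : dirIter L (j + 1) U Xt = vt := (chartDir_levelQ'_eq_dirIter hL1 j hU hUP' hx hs hUx X.2).symm
  obtain ⟨mu, hmus, hmuP, hmu0, hdir, hmem⟩ := exists_cornerGauge_sliceRep (N := N) hL hLd (by norm_num) j hU hUP hx hs hUx hcr hE hXts hXtP hvs hvP hXφ
  have hmuP' : ∀ (y : Site 4) (i : Fin 4), mu (y + ((L * tower L N j : ℕ) : ℤ) • e i) = mu y := hmuP
  refine ⟨mu, hmus, hmuP', hmu0, ?_⟩
  have hGs : IsSkewDir (gaugeDir U mu) := gaugeDir_skew hU hmus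
  have hGP : IsPeriodicDir (gaugeDir U mu) ((L * tower L N j : ℕ) : ℤ) := isPeriodicDir_gaugeDir hUP hmuP
  set X' : ↥(skewSub 4 n (L * tower L N j)) := X + skewPR (d := 4) (n := n) (L * tower L N j) (resDir (L * tower L N j) (gaugeDir U mu)) with hX'
  have hchart : chartDir (ContinuousLinearMap.id ℝ (Matrix n n ℂ)) (L * tower L N j) (X' : TDir 4 n (L * tower L N j)) = fun y ν => Xt y ν + gaugeDir U mu y ν := by
    funext y ν
    exact chartDir_add_skewPR_resDir (X : TDir 4 n (L * tower L N j)) hGs hGP y ν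
  have hq : levelQ' L N j U (X' : TDir 4 n (L * tower L N j)) = levelQ' L N j U (X : TDir 4 n (L * tower L N j)) := by
    apply Subtype.ext
    apply eq_of_chartDir_eq
    rw [chartDir_levelQ'_eq_dirIter hL1 j hU hUP' hx hs hUx X'.2, hchart, hdir, hvt]
  set R := rightInvW0 hL j hU hx hs hUx N hcr hE hvs with hR
  have hslice : (fun y ν => chartDir (ContinuousLinearMap.id ℝ (Matrix n n ℂ)) (L * tower L N j) (X' : TDir 4 n (L * tower L N j)) y ν - R y ν)
      ∈ frameFreeBlockLandauW (d := 4) (n := n) L N (j + 1) U := by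
    rw [hchart]; exact hmem
  refine ⟨hq, hslice, ?_⟩
  -- the lift's letters
  have hRff : ∀ z : Site 4, framePotW L (j + 1) U R z = 0 := fun z => framePotW_rightInvW0 hL j hU hx hs hUx N hcr hE hvs hUP ⟨0, by omega⟩ z
  have hRA0 := dirSq_rightInvW0_class_le hL j hU hx hs hUx N hcr hE hUP hθl2' hε1' hvs (by norm_num)
  have hRB0 := curlSq_rightInvW0_class_le hL j hU hx hs hUx N hcr hE hUP hθl2' hε1' hvs
  rw [← tower_eq_mul_pow] at hRA0 hRB0
  set m := dirSq vt (periodBox (d := 4) N) with hm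
  have hM0 : (0 : ℝ) < (L : ℝ) ^ (j + 1) := by
    have hL0 : (0 : ℝ) < L := by exact_mod_cast (show 0 < L by omega)
    positivity
  have e42 : ((L : ℝ) ^ (j + 1)) ^ 4 / ((L : ℝ) ^ (j + 1)) ^ 2 = ((L : ℝ) ^ (j + 1)) ^ 2 := by
    rw [div_eq_iff (by positivity)]; ring
  have e44 : ((L : ℝ) ^ (j + 1)) ^ 4 / ((L : ℝ) ^ (j + 1)) ^ 4 = 1 := div_self (by positivity)
  rw [e42] at hRA0
  rw [e44, one_mul] at hRB0
  have hqq : ((L : ℝ)⁻¹) ^ (2 * (j + 1)) * ((L : ℝ) ^ (j + 1)) ^ 2 = 1 := by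
    rw [← inv_pow_sq_eq, ← mul_pow, inv_mul_cancel₀ hM0.ne', one_pow]
  have e : 2 * ((L : ℝ)⁻¹) ^ (2 * (j + 1)) * (((L : ℝ) ^ (j + 1)) ^ 2 * liftMassC 4 L * m) + 4 * CP * (liftCurlC 4 L * m)
      = (2 * liftMassC 4 L + 4 * CP * liftCurlC 4 L) * m := by
    calc 2 * ((L : ℝ)⁻¹) ^ (2 * (j + 1)) * (((L : ℝ) ^ (j + 1)) ^ 2 * liftMassC 4 L * m) + 4 * CP * (liftCurlC 4 L * m)
        = (2 * (((L : ℝ)⁻¹) ^ (2 * (j + 1)) * ((L : ℝ) ^ (j + 1)) ^ 2) * liftMassC 4 L + 4 * CP * liftCurlC 4 L) * m := by ring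
      _ = _ := by rw [hqq, mul_one]
  -- (c) the floor
  have hc := coarse_curl_le_hess_of_mem_slice hL hN hε hεD hεT hεM j hU hUP hUx X'.2 hRff hCP hRA0 hRB0 hslice hSP habs hθ
  rw [hq, e] at hc
  -- (d), (e) the absorbed scaled mass and the fine energy
  have hYff : ∀ z : Site 4, framePotW L (j + 1) U (fun y ν => chartDir (ContinuousLinearMap.id ℝ (Matrix n n ℂ)) (L * tower L N j) (X' : TDir 4 n (L * tower L N j)) y ν - R y ν) z = 0 :=
    hslice.2.2.2.1
  have hP0 := hSP _ hslice
  rw [← tower_eq_mul_pow, inv_pow_sq_eq] at hP0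
  have hde := scaledMass_le_of_sliceRep hε j hU hUx X'.2 hCP hRA0 hRB0 hP0 habs
  rw [e] at hde
  exact ⟨hc, hde.1, hde.2⟩

end

end Summit.QuantumFields.BalabanUV.T4Continuum.NE7SliceRepLetters
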